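import Mathlib
import HarnessLib
import Summits.NavierStokesRegularity.NavierStokesRegularity.Theorems.PoloidalWindowDoorPoloidalWindowRigidityUntwistedSeparation2
import Summits.NavierStokesRegularity.NavierStokesRegularity.Theorems.PoloidalWindowDoorPoloidalWindowRigidityUntwistedLeafRegularity

/-!
# Route `PoloidalWindowDoor`, crux `PoloidalWindowRigidity` (K2, stmt-NavierStokesRegularity-19708), skeleton `lrc-jet` v5,
# stub `stub_untwisted` — glue F3 → F5: WHERE A SEPARATION WRONSKIAN IS NON-ZERO AT ONE NON-DEGENERATE POINT, THE GERM FOLLOWS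

Cell ns-regularity-ideate, seat ns-poloidal-K2-p3 (gen 6; `--supports stmt-NavierStokesRegularity-19708`, helper toward `stub_untwisted` of
`Cruxes/PoloidalWindowRigidity/Lines/lrc_jet.lean` v5 and toward item stmt-20428 `LrcModEntire` (skeleton twist-split, stub `stub_untwistedGerm`)).
ASSEMBLY GLUE between the K2 lead's separation bricks and this seat's isoparametric endgame, in the class setting `w = v₂(s,·)`:

* `continuousAt_wronskian₁` / `continuousAt_wronskian₃` — the height-Wronskians `D₁` (of `…UntwistedSeparation.leafwise_of_wronskian_ne_zero`, F3a)
  and `D₃` (of `…UntwistedSeparation2.leafwise_of_dynWronskian_ne_zero`, F3b), as functions of the point `y`, are continuous at every point of `U`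
  under those files' own regularity hypotheses (`P, Λ` of class `C²` at the leaf points) — so `D ≠ 0` at one point gives an open set where `D ≠ 0`.
* `lrcGerm_of_wronskian₁_ne_zero` / `not_isBackwardSingularPoint_of_wronskian₁_ne_zero` — **BRANCH 1 ⇒ GERM:** class profile, slice `s < 0`,
  `w = v₂(s,·)`, the hypotheses of F3a VERBATIM on an open `U`, and ONE point `y₁ ∈ U` with `D₁(y₁) ≠ 0` and `∇ₕw(y₁) ≠ 0` ⇒ the `LrcModEntire`
  germ, resp. `¬ IsBackwardSingularPoint v 0` (F3a on the open set `U ∩ {D₁ ≠ 0} ∋ y₁`, then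
  `…UntwistedLeafRegularity.lrcGerm_of_leafwise'` — no regularity of the Cramer quotients is needed).
* `lrcGerm_of_wronskian₃_ne_zero` / `not_isBackwardSingularPoint_of_wronskian₃_ne_zero` — **BRANCH 2a ⇒ GERM:** the same with the hypotheses
  of F3b VERBATIM (plus `P ∈ C¹` at the leaf points and the pin `Λ ≠ 0` on `U`) and `D₃(y₁) ≠ 0`.

So the untwisted assembly reads: F2 (structure functions and the identities hP/hK1/hV0/hSz on an open `U ∋ y₀` of one slice) ⇒ EITHER some
`y₁ ∈ U` has `D₁(y₁) ≠ 0` or `D₃(y₁) ≠ 0` (this file ⇒ germ ⇒ done) OR `D₁ ≡ D₃ ≡ 0` on `U` (the lead's `…UntwistedStuartTranslation3.branch2b_false`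
⇒ `False`).  WHAT THIS IS NOT: not a claim about Navier–Stokes regularity and not the stub — glue (bears_on LADDER-NS N0 via crux K2 = stmt-19708
and item stmt-20428).
-/

noncomputable section

-- the summit and its single sub-problem share the name (CONVENTIONS §1), as in every Theorems file
set_option linter.dupNamespace false

namespace Summit.NavierStokesRegularity.NavierStokesRegularity.Theorems.PoloidalWindowDoorPoloidalWindowRigidityUntwistedLeafwiseGerm

open Set Function Filter Topology Metric
open scoped RealInnerProductSpace InnerProductSpace ContDiff
open Literature.Analysis Literature.Analysis.FluidPDE
open Summit.NavierStokesRegularity.NavierStokesRegularity.Theorems.LocalSineTubeDoorProfileAlignedWindowRigidityAncient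
open Summit.NavierStokesRegularity.NavierStokesRegularity.Theorems.PoloidalWindowDoorPoloidalWindowRigidityConstantShearMeans
open Summit.NavierStokesRegularity.NavierStokesRegularity.Theorems.PoloidalWindowDoorPoloidalWindowRigidityUntwistedKinematics
open Summit.NavierStokesRegularity.NavierStokesRegularity.Theorems.PoloidalWindowDoorPoloidalWindowRigidityUntwistedSeparation
open Summit.NavierStokesRegularity.NavierStokesRegularity.Theorems.PoloidalWindowDoorPoloidalWindowRigidityUntwistedSeparation2
open Summit.NavierStokesRegularity.NavierStokesRegularity.Theorems.PoloidalWindowDoorPoloidalWindowRigidityUntwistedLeafRegularity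

/-! ### Continuity of the Wronskians as functions of the point -/

section Continuity

variable {w : EuclideanSpace ℝ (Fin 3) → ℝ} {P Λ : ℝ × ℝ → ℝ} {U : Set (EuclideanSpace ℝ (Fin 3))}

/-- Continuity at `y` of the leafwise scalars entering the Wronskians: `Λ`, `Λ_w`, `Λ̇`, `Λ̇_w`, `P`, `P_w`, `P_ww` evaluated at the leaf point
`(w y, y₂)`, when `P, Λ` are `C²` at that leaf point and `w` is continuous. [folklore] -/
theorem continuousAt_leafScalars (hw : Continuous w) {y : EuclideanSpace ℝ (Fin 3)}
    (hPd : ContDiffAt ℝ 2 P (w y, y 2)) (hΛd : ContDiffAt ℝ 2 Λ (w y, y 2)) :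
    ContinuousAt (fun y' => Λ (w y', y' 2)) y ∧
    ContinuousAt (fun y' => fderiv ℝ Λ (w y', y' 2) (1, 0)) y ∧
    ContinuousAt (fun y' => fderiv ℝ Λ (w y', y' 2) (P (w y', y' 2), 1)) y ∧
    ContinuousAt (fun y' => fderiv ℝ (fun q => fderiv ℝ Λ q ((1 : ℝ), (0 : ℝ))) (w y', y' 2) (P (w y', y' 2), 1)) y ∧
    ContinuousAt (fun y' => P (w y', y' 2)) y ∧
    ContinuousAt (fun y' => fderiv ℝ P (w y', y' 2) (1, 0)) y ∧
    ContinuousAt (fun y' => fderiv ℝ (fun q => fderiv ℝ P q ((1 : ℝ), (0 : ℝ))) (w y', y' 2) (1, 0)) y := by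
  have hL : ContinuousAt (fun y' : EuclideanSpace ℝ (Fin 3) => (w y', y' 2)) y := continuousAt_leafMap hw.continuousAt
  -- generic facts for a `C²` function `g` at the leaf point
  have key : ∀ {g : ℝ × ℝ → ℝ}, ContDiffAt ℝ 2 g (w y, y 2) →
      ContinuousAt (fun y' => g (w y', y' 2)) y ∧
      ContinuousAt (fun y' => fderiv ℝ g (w y', y' 2)) y ∧
      ContinuousAt (fun y' => fderiv ℝ (fun q => fderiv ℝ g q ((1 : ℝ), (0 : ℝ))) (w y', y' 2)) y := by
    intro g hg
    have h1 : ContDiffAt ℝ 1 (fderiv ℝ g) (w y, y 2) := hg.fderiv_right (m := 1) (by norm_num)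
    have h2 : ContDiffAt ℝ 1 (fun q => fderiv ℝ g q ((1 : ℝ), (0 : ℝ))) (w y, y 2) := h1.clm_apply contDiffAt_const
    have h3 : ContDiffAt ℝ 0 (fderiv ℝ (fun q => fderiv ℝ g q ((1 : ℝ), (0 : ℝ)))) (w y, y 2) := h2.fderiv_right (m := 0) le_rfl
    refine ⟨?_, ?_, ?_⟩
    · exact ContinuousAt.comp (f := fun y' : EuclideanSpace ℝ (Fin 3) => (w y', y' 2)) hg.continuousAt hL
    · exact ContinuousAt.comp (f := fun y' : EuclideanSpace ℝ (Fin 3) => (w y', y' 2)) h1.continuousAt hL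
    · exact ContinuousAt.comp (f := fun y' : EuclideanSpace ℝ (Fin 3) => (w y', y' 2)) h3.continuousAt hL
  obtain ⟨hΛ0, hΛ1, hΛ2⟩ := key hΛd
  obtain ⟨hP0, hP1, hP2⟩ := key hPd
  have hdir : ContinuousAt (fun y' : EuclideanSpace ℝ (Fin 3) => (P (w y', y' 2), (1 : ℝ))) y := hP0.prodMk continuousAt_const
  exact ⟨hΛ0, hΛ1.clm_apply continuousAt_const, hΛ1.clm_apply hdir, hΛ2.clm_apply hdir, hP0, hP1.clm_apply continuousAt_const,
    hP2.clm_apply continuousAt_const⟩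

/-- **The Wronskian `D₁` of F3a is continuous at every point where `P, Λ ∈ C²` at the leaf point.** [folklore] -/
theorem continuousAt_wronskian₁ (hw : Continuous w) {y : EuclideanSpace ℝ (Fin 3)}
    (hPd : ContDiffAt ℝ 2 P (w y, y 2)) (hΛd : ContDiffAt ℝ 2 Λ (w y, y 2)) :
    ContinuousAt (fun y' => Λ (w y', y' 2) * (Λ (w y', y' 2) * fderiv ℝ (fun q => fderiv ℝ P q ((1 : ℝ), (0 : ℝ))) (w y', y' 2) (1, 0) +
            fderiv ℝ (fun q => fderiv ℝ Λ q ((1 : ℝ), (0 : ℝ))) (w y', y' 2) (P (w y', y' 2), 1) +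
            2 * fderiv ℝ Λ (w y', y' 2) (1, 0) * fderiv ℝ P (w y', y' 2) (1, 0)) -
          fderiv ℝ Λ (w y', y' 2) (1, 0) *
            (fderiv ℝ Λ (w y', y' 2) (P (w y', y' 2), 1) + Λ (w y', y' 2) * fderiv ℝ P (w y', y' 2) (1, 0))) y := by
  obtain ⟨hΛ0, hΛw, hΛd', hΛwd, -, hPw, hPww⟩ := continuousAt_leafScalars hw hPd hΛd
  exact (hΛ0.mul (((hΛ0.mul hPww).add hΛwd).add ((continuousAt_const.mul hΛw).mul hPw))).sub (hΛw.mul (hΛd'.add (hΛ0.mul hPw)))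

/-- **The Wronskian `D₃` of F3b is continuous at every point where `P, Λ ∈ C²` at the leaf point.** [folklore] -/
theorem continuousAt_wronskian₃ (hw : Continuous w) {y : EuclideanSpace ℝ (Fin 3)}
    (hPd : ContDiffAt ℝ 2 P (w y, y 2)) (hΛd : ContDiffAt ℝ 2 Λ (w y, y 2)) :
    ContinuousAt (fun y' => (Λ (w y', y' 2) * (1 - Λ (w y', y' 2))) *
            (Λ (w y', y' 2) * (1 - Λ (w y', y' 2)) * Λ (w y', y' 2) +
              fderiv ℝ (fun q => fderiv ℝ Λ q ((1 : ℝ), (0 : ℝ))) (w y', y' 2) (P (w y', y' 2), 1) +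
              2 * fderiv ℝ Λ (w y', y' 2) (1, 0) * fderiv ℝ P (w y', y' 2) (1, 0)) -
          fderiv ℝ Λ (w y', y' 2) (1, 0) *
            ((1 - 2 * Λ (w y', y' 2)) * fderiv ℝ Λ (w y', y' 2) (P (w y', y' 2), 1) +
              Λ (w y', y' 2) * (1 - Λ (w y', y' 2)) * fderiv ℝ P (w y', y' 2) (1, 0))) y := by
  obtain ⟨hΛ0, hΛw, hΛd', hΛwd, -, hPw, -⟩ := continuousAt_leafScalars hw hPd hΛd
  have hN : ContinuousAt (fun y' => Λ (w y', y' 2) * (1 - Λ (w y', y' 2))) y := hΛ0.mul (continuousAt_const.sub hΛ0)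
  exact (hN.mul (((hN.mul hΛ0).add hΛwd).add ((continuousAt_const.mul hΛw).mul hPw))).sub
    (hΛw.mul (((continuousAt_const.sub (continuousAt_const.mul hΛ0)).mul hΛd').add (hN.mul hPw)))

end Continuity

/-! ### An open set of leafwise points around one point where a Wronskian is non-zero (pure calculus) -/

section Calculus

variable {w : EuclideanSpace ℝ (Fin 3) → ℝ}

/-- **Branch 1, localised.**  Under the hypotheses of `…UntwistedSeparation.leafwise_of_wronskian_ne_zero` on an open `U` (`w ∈ C³`) and at a point
`y₁ ∈ U` with `D₁(y₁) ≠ 0`, there are an open `U₁ ∋ y₁` inside `U` and functions `a, b` with `|∇ₕw|² = a(w,y₂)` and `Δₕw = b(w,y₂)` on ALL of `U₁`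
(`D₁` is continuous, `continuousAt_wronskian₁`). [folklore] -/
theorem exists_leafwise_nhds_of_wronskian₁_ne_zero (hw : ContDiff ℝ 3 w)
    {P Λ c : ℝ × ℝ → ℝ} {U : Set (EuclideanSpace ℝ (Fin 3))} (hU : IsOpen U)
    (hPd : ∀ y ∈ U, ContDiffAt ℝ 2 P (w y, y 2)) (hΛd : ∀ y ∈ U, ContDiffAt ℝ 2 Λ (w y, y 2))
    (hcd : ∀ y ∈ U, DifferentiableAt ℝ c (w y, y 2))
    (hP : ∀ y ∈ U, fderiv ℝ w y (EuclideanSpace.single 2 (1 : ℝ)) = P (w y, y 2))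
    (hK1 : ∀ y ∈ U, Λ (w y, y 2) *
        (fderiv ℝ (fun y' => fderiv ℝ w y' (EuclideanSpace.single 0 (1 : ℝ))) y (EuclideanSpace.single 0 (1 : ℝ)) + fderiv ℝ (fun y' => fderiv ℝ w y' (EuclideanSpace.single 1 (1 : ℝ))) y (EuclideanSpace.single 1 (1 : ℝ))) +
      fderiv ℝ Λ (w y, y 2) (1, 0) * (fderiv ℝ w y (EuclideanSpace.single 0 (1 : ℝ)) ^ 2 + fderiv ℝ w y (EuclideanSpace.single 1 (1 : ℝ)) ^ 2) + c (w y, y 2) = 0)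
    {y₁ : EuclideanSpace ℝ (Fin 3)} (hy₁ : y₁ ∈ U)
    (hD : Λ (w y₁, y₁ 2) * (Λ (w y₁, y₁ 2) * fderiv ℝ (fun q => fderiv ℝ P q ((1 : ℝ), (0 : ℝ))) (w y₁, y₁ 2) (1, 0) +
            fderiv ℝ (fun q => fderiv ℝ Λ q ((1 : ℝ), (0 : ℝ))) (w y₁, y₁ 2) (P (w y₁, y₁ 2), 1) +
            2 * fderiv ℝ Λ (w y₁, y₁ 2) (1, 0) * fderiv ℝ P (w y₁, y₁ 2) (1, 0)) -
          fderiv ℝ Λ (w y₁, y₁ 2) (1, 0) *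
            (fderiv ℝ Λ (w y₁, y₁ 2) (P (w y₁, y₁ 2), 1) + Λ (w y₁, y₁ 2) * fderiv ℝ P (w y₁, y₁ 2) (1, 0)) ≠ 0) :
    ∃ U₁ : Set (EuclideanSpace ℝ (Fin 3)), IsOpen U₁ ∧ y₁ ∈ U₁ ∧ U₁ ⊆ U ∧ ∃ a b : ℝ × ℝ → ℝ, ∀ y ∈ U₁,
      fderiv ℝ w y (EuclideanSpace.single 0 (1 : ℝ)) ^ 2 + fderiv ℝ w y (EuclideanSpace.single 1 (1 : ℝ)) ^ 2 = a (w y, y 2) ∧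
      fderiv ℝ (fun y' => fderiv ℝ w y' (EuclideanSpace.single 0 (1 : ℝ))) y (EuclideanSpace.single 0 (1 : ℝ)) +
        fderiv ℝ (fun y' => fderiv ℝ w y' (EuclideanSpace.single 1 (1 : ℝ))) y (EuclideanSpace.single 1 (1 : ℝ)) = b (w y, y 2) := by
  obtain ⟨a, b, hab⟩ := leafwise_of_wronskian_ne_zero hU hw hPd hΛd hcd hP hK1
  have hDc := continuousAt_wronskian₁ hw.continuous (hPd y₁ hy₁) (hΛd y₁ hy₁)
  have hev : ∀ᶠ y in 𝓝 y₁, y ∈ U ∧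
      Λ (w y, y 2) * (Λ (w y, y 2) * fderiv ℝ (fun q => fderiv ℝ P q ((1 : ℝ), (0 : ℝ))) (w y, y 2) (1, 0) +
            fderiv ℝ (fun q => fderiv ℝ Λ q ((1 : ℝ), (0 : ℝ))) (w y, y 2) (P (w y, y 2), 1) +
            2 * fderiv ℝ Λ (w y, y 2) (1, 0) * fderiv ℝ P (w y, y 2) (1, 0)) -
          fderiv ℝ Λ (w y, y 2) (1, 0) *
            (fderiv ℝ Λ (w y, y 2) (P (w y, y 2), 1) + Λ (w y, y 2) * fderiv ℝ P (w y, y 2) (1, 0)) ≠ 0 := by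
    have h1 : ∀ᶠ y in 𝓝 y₁, y ∈ U := hU.mem_nhds hy₁
    exact h1.and (hDc.eventually_ne hD)
  obtain ⟨U₁, hU₁sub, hU₁o, hy₁U₁⟩ := _root_.mem_nhds_iff.1 hev
  exact ⟨U₁, hU₁o, hy₁U₁, fun y hy => (hU₁sub hy).1, a, b, fun y hy =>
    hab y (hU₁sub hy).1 (hU₁sub hy).2⟩

/-- **Branch 2a, localised.**  Under the hypotheses of `…UntwistedSeparation2.leafwise_of_dynWronskian_ne_zero` on an open `U` (`w ∈ C³`; here with
`P ∈ C²` at the leaf points and the pin `Λ ≠ 0` on `U`) and at a point `y₁ ∈ U` with `D₃(y₁) ≠ 0`, there are an open `U₁ ∋ y₁` inside `U` and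
functions `a, b` with `|∇ₕw|² = a(w,y₂)` and `Δₕw = b(w,y₂)` on `U₁`. [folklore] -/
theorem exists_leafwise_nhds_of_wronskian₃_ne_zero (hw : ContDiff ℝ 3 w)
    {P Λ c k pt : ℝ × ℝ → ℝ} {S : EuclideanSpace ℝ (Fin 3) → ℝ} {U : Set (EuclideanSpace ℝ (Fin 3))} (hU : IsOpen U)
    (hPd : ∀ y ∈ U, ContDiffAt ℝ 2 P (w y, y 2)) (hΛd : ∀ y ∈ U, ContDiffAt ℝ 2 Λ (w y, y 2))
    (hcd : ∀ y ∈ U, DifferentiableAt ℝ c (w y, y 2)) (hkd : ∀ y ∈ U, DifferentiableAt ℝ k (w y, y 2))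
    (hSd : ∀ y ∈ U, DifferentiableAt ℝ S y)
    (hΛ0 : ∀ y ∈ U, Λ (w y, y 2) ≠ 0)
    (hP : ∀ y ∈ U, fderiv ℝ w y (EuclideanSpace.single 2 (1 : ℝ)) = P (w y, y 2))
    (hSz : ∀ y ∈ U, fderiv ℝ S y (EuclideanSpace.single 2 (1 : ℝ)) =
      fderiv ℝ P (w y, y 2) (1, 0) * S y + Λ (w y, y 2) *
        (fderiv ℝ w y (EuclideanSpace.single 0 (1 : ℝ)) ^ 2 + fderiv ℝ w y (EuclideanSpace.single 1 (1 : ℝ)) ^ 2) + pt (w y, y 2))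
    (hK1 : ∀ y ∈ U, Λ (w y, y 2) *
        (fderiv ℝ (fun y' => fderiv ℝ w y' (EuclideanSpace.single 0 (1 : ℝ))) y (EuclideanSpace.single 0 (1 : ℝ)) +
          fderiv ℝ (fun y' => fderiv ℝ w y' (EuclideanSpace.single 1 (1 : ℝ))) y (EuclideanSpace.single 1 (1 : ℝ))) +
      fderiv ℝ Λ (w y, y 2) (1, 0) *
        (fderiv ℝ w y (EuclideanSpace.single 0 (1 : ℝ)) ^ 2 + fderiv ℝ w y (EuclideanSpace.single 1 (1 : ℝ)) ^ 2) + c (w y, y 2) = 0)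
    (hV0 : ∀ y ∈ U, (1 - Λ (w y, y 2)) * S y = (1 - Λ (w y, y 2)) *
        (fderiv ℝ (fun y' => fderiv ℝ w y' (EuclideanSpace.single 0 (1 : ℝ))) y (EuclideanSpace.single 0 (1 : ℝ)) +
          fderiv ℝ (fun y' => fderiv ℝ w y' (EuclideanSpace.single 1 (1 : ℝ))) y (EuclideanSpace.single 1 (1 : ℝ))) -
      fderiv ℝ Λ (w y, y 2) (1, 0) *
        (fderiv ℝ w y (EuclideanSpace.single 0 (1 : ℝ)) ^ 2 + fderiv ℝ w y (EuclideanSpace.single 1 (1 : ℝ)) ^ 2) + k (w y, y 2))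
    {y₁ : EuclideanSpace ℝ (Fin 3)} (hy₁ : y₁ ∈ U)
    (hD : (Λ (w y₁, y₁ 2) * (1 - Λ (w y₁, y₁ 2))) *
            (Λ (w y₁, y₁ 2) * (1 - Λ (w y₁, y₁ 2)) * Λ (w y₁, y₁ 2) +
              fderiv ℝ (fun q => fderiv ℝ Λ q ((1 : ℝ), (0 : ℝ))) (w y₁, y₁ 2) (P (w y₁, y₁ 2), 1) +
              2 * fderiv ℝ Λ (w y₁, y₁ 2) (1, 0) * fderiv ℝ P (w y₁, y₁ 2) (1, 0)) -
          fderiv ℝ Λ (w y₁, y₁ 2) (1, 0) *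
            ((1 - 2 * Λ (w y₁, y₁ 2)) * fderiv ℝ Λ (w y₁, y₁ 2) (P (w y₁, y₁ 2), 1) +
              Λ (w y₁, y₁ 2) * (1 - Λ (w y₁, y₁ 2)) * fderiv ℝ P (w y₁, y₁ 2) (1, 0)) ≠ 0) :
    ∃ U₁ : Set (EuclideanSpace ℝ (Fin 3)), IsOpen U₁ ∧ y₁ ∈ U₁ ∧ U₁ ⊆ U ∧ ∃ a b : ℝ × ℝ → ℝ, ∀ y ∈ U₁,
      fderiv ℝ w y (EuclideanSpace.single 0 (1 : ℝ)) ^ 2 + fderiv ℝ w y (EuclideanSpace.single 1 (1 : ℝ)) ^ 2 = a (w y, y 2) ∧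
      fderiv ℝ (fun y' => fderiv ℝ w y' (EuclideanSpace.single 0 (1 : ℝ))) y (EuclideanSpace.single 0 (1 : ℝ)) +
        fderiv ℝ (fun y' => fderiv ℝ w y' (EuclideanSpace.single 1 (1 : ℝ))) y (EuclideanSpace.single 1 (1 : ℝ)) = b (w y, y 2) := by
  have hw2 : ContDiff ℝ 2 w := hw.of_le (by norm_num)
  obtain ⟨a, b, hab⟩ := leafwise_of_dynWronskian_ne_zero hU hw2 (fun y hy => (hPd y hy).differentiableAt (by norm_num)) hΛd hcd hkd hSd
    hP hSz hK1 hV0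
  have hDc := continuousAt_wronskian₃ hw.continuous (hPd y₁ hy₁) (hΛd y₁ hy₁)
  have hev : ∀ᶠ y in 𝓝 y₁, y ∈ U ∧
      (Λ (w y, y 2) * (1 - Λ (w y, y 2))) *
            (Λ (w y, y 2) * (1 - Λ (w y, y 2)) * Λ (w y, y 2) +
              fderiv ℝ (fun q => fderiv ℝ Λ q ((1 : ℝ), (0 : ℝ))) (w y, y 2) (P (w y, y 2), 1) +
              2 * fderiv ℝ Λ (w y, y 2) (1, 0) * fderiv ℝ P (w y, y 2) (1, 0)) -
          fderiv ℝ Λ (w y, y 2) (1, 0) *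
            ((1 - 2 * Λ (w y, y 2)) * fderiv ℝ Λ (w y, y 2) (P (w y, y 2), 1) +
              Λ (w y, y 2) * (1 - Λ (w y, y 2)) * fderiv ℝ P (w y, y 2) (1, 0)) ≠ 0 := by
    have h1 : ∀ᶠ y in 𝓝 y₁, y ∈ U := hU.mem_nhds hy₁
    exact h1.and (hDc.eventually_ne hD)
  obtain ⟨U₁, hU₁sub, hU₁o, hy₁U₁⟩ := _root_.mem_nhds_iff.1 hev
  exact ⟨U₁, hU₁o, hy₁U₁, fun y hy => (hU₁sub hy).1, a, b, fun y hy =>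
    ⟨(hab y (hU₁sub hy).1 (hU₁sub hy).2).1, (hab y (hU₁sub hy).1 (hU₁sub hy).2).2 (hΛ0 y (hU₁sub hy).1)⟩⟩

end Calculus

/-! ### Class form: Branch 1 / Branch 2a at one non-degenerate point ⇒ the germ, resp. not backward-singular -/

variable {C : ℝ} {v : ℝ → EuclideanSpace ℝ (Fin 3) → EuclideanSpace ℝ (Fin 3)}

/-- **BRANCH 1 ⇒ THE `LrcModEntire` GERM.**  Let `v` be a profile of the route's Type-I class, poloidal along `e₃`, `s < 0`, `w = v₂(s,·)`; assume the
hypotheses of `…UntwistedSeparation.leafwise_of_wronskian_ne_zero` on an open `U` and ONE point `y₁ ∈ U` with `D₁(y₁) ≠ 0` and `∇ₕw(y₁) ≠ 0`.  Then the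
germ trichotomy of item `LrcModEntire` holds (first two legs, on the slice `s`). [folklore] -/
theorem lrcGerm_of_wronskian₁_ne_zero (hrate : HasTypeITimeDecay C v)
    (hcont : ContinuousOn (uncurry v) (Iio (0 : ℝ) ×ˢ univ))
    (hmild : ∀ s t : ℝ, s < t → t < 0 → ∀ x,
      v t x = UnboundedOperators.heatExtension (v s) (t - s) x - oseenDuhamel 1 s v v t x)
    (hdiv : ∀ t < 0, VectorCalculus.IsDivFree (v t))
    (hpol : ∀ s < 0, ∀ y, ⟪curl (v s) y, EuclideanSpace.single 2 1⟫_ℝ = 0)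
    {s : ℝ} (hs : s < 0) {w : EuclideanSpace ℝ (Fin 3) → ℝ} (hwv : w = fun x => v s x 2)
    {P Λ c : ℝ × ℝ → ℝ} {U : Set (EuclideanSpace ℝ (Fin 3))} (hU : IsOpen U)
    (hPd : ∀ y ∈ U, ContDiffAt ℝ 2 P (w y, y 2)) (hΛd : ∀ y ∈ U, ContDiffAt ℝ 2 Λ (w y, y 2))
    (hcd : ∀ y ∈ U, DifferentiableAt ℝ c (w y, y 2))
    (hP : ∀ y ∈ U, fderiv ℝ w y (EuclideanSpace.single 2 (1 : ℝ)) = P (w y, y 2))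
    (hK1 : ∀ y ∈ U, Λ (w y, y 2) *
        (fderiv ℝ (fun y' => fderiv ℝ w y' (EuclideanSpace.single 0 (1 : ℝ))) y (EuclideanSpace.single 0 (1 : ℝ)) + fderiv ℝ (fun y' => fderiv ℝ w y' (EuclideanSpace.single 1 (1 : ℝ))) y (EuclideanSpace.single 1 (1 : ℝ))) +
      fderiv ℝ Λ (w y, y 2) (1, 0) * (fderiv ℝ w y (EuclideanSpace.single 0 (1 : ℝ)) ^ 2 + fderiv ℝ w y (EuclideanSpace.single 1 (1 : ℝ)) ^ 2) + c (w y, y 2) = 0)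
    {y₁ : EuclideanSpace ℝ (Fin 3)} (hy₁ : y₁ ∈ U)
    (hD : Λ (w y₁, y₁ 2) * (Λ (w y₁, y₁ 2) * fderiv ℝ (fun q => fderiv ℝ P q ((1 : ℝ), (0 : ℝ))) (w y₁, y₁ 2) (1, 0) +
            fderiv ℝ (fun q => fderiv ℝ Λ q ((1 : ℝ), (0 : ℝ))) (w y₁, y₁ 2) (P (w y₁, y₁ 2), 1) +
            2 * fderiv ℝ Λ (w y₁, y₁ 2) (1, 0) * fderiv ℝ P (w y₁, y₁ 2) (1, 0)) -
          fderiv ℝ Λ (w y₁, y₁ 2) (1, 0) *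
            (fderiv ℝ Λ (w y₁, y₁ 2) (P (w y₁, y₁ 2), 1) + Λ (w y₁, y₁ 2) * fderiv ℝ P (w y₁, y₁ 2) (1, 0)) ≠ 0)
    (hnd : fderiv ℝ w y₁ (EuclideanSpace.single 0 (1 : ℝ)) ≠ 0 ∨ fderiv ℝ w y₁ (EuclideanSpace.single 1 (1 : ℝ)) ≠ 0) :
    ∃ s' : ℝ, s' < 0 ∧ ∃ U' : Set (EuclideanSpace ℝ (Fin 3)), IsOpen U' ∧ U'.Nonempty ∧
      ((∃ e : EuclideanSpace ℝ (Fin 3), e ≠ 0 ∧ ∀ y ∈ U', fderiv ℝ (curl (v s')) y e = 0) ∨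
       (∃ c : EuclideanSpace ℝ (Fin 3), ∀ y ∈ U',
          rotGen (curl (v s') y) = fderiv ℝ (curl (v s')) y (rotGen (y - c))) ∨
       (∃ w : EuclideanSpace ℝ (Fin 3) → EuclideanSpace ℝ (Fin 3), AnalyticOnNhd ℝ w univ ∧
          ¬ BddAbove (Set.range fun y => ‖w y‖) ∧ ∀ y ∈ U', v s' y = w y)) := by
  have hA : AnalyticOnNhd ℝ (v s) univ := analyticOnNhd_slice hcont (bdd_of_hasTypeITimeDecay hrate) hmild hs
  have hw3 : ContDiff ℝ 3 w := by rw [hwv]; exact contDiff_coord hA.contDiff 2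
  obtain ⟨U₁, hU₁o, hy₁U₁, hU₁U, a, b, hab⟩ := exists_leafwise_nhds_of_wronskian₁_ne_zero hw3 hU hPd hΛd hcd hP hK1 hy₁ hD
  subst hwv
  exact lrcGerm_of_leafwise' hrate hcont hmild hdiv hpol hs hU₁o hy₁U₁ (P := P) (a := a) (b := b)
    (fun y hy => (hPd y (hU₁U hy)).of_le (by norm_num)) (fun y hy => hP y (hU₁U hy))
    (fun y hy => (hab y hy).1) (fun y hy => (hab y hy).2) hnd

/-- **BRANCH 1 ⇒ `¬ IsBackwardSingularPoint`** (same hypotheses; the currency of the K2 lead's `stub_untwisted`). [folklore] -/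
theorem not_isBackwardSingularPoint_of_wronskian₁_ne_zero (hrate : HasTypeITimeDecay C v)
    (hcont : ContinuousOn (uncurry v) (Iio (0 : ℝ) ×ˢ univ))
    (hmild : ∀ s t : ℝ, s < t → t < 0 → ∀ x,
      v t x = UnboundedOperators.heatExtension (v s) (t - s) x - oseenDuhamel 1 s v v t x)
    (hdiv : ∀ t < 0, VectorCalculus.IsDivFree (v t))
    (hpol : ∀ s < 0, ∀ y, ⟪curl (v s) y, EuclideanSpace.single 2 1⟫_ℝ = 0)
    {s : ℝ} (hs : s < 0) {w : EuclideanSpace ℝ (Fin 3) → ℝ} (hwv : w = fun x => v s x 2)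
    {P Λ c : ℝ × ℝ → ℝ} {U : Set (EuclideanSpace ℝ (Fin 3))} (hU : IsOpen U)
    (hPd : ∀ y ∈ U, ContDiffAt ℝ 2 P (w y, y 2)) (hΛd : ∀ y ∈ U, ContDiffAt ℝ 2 Λ (w y, y 2))
    (hcd : ∀ y ∈ U, DifferentiableAt ℝ c (w y, y 2))
    (hP : ∀ y ∈ U, fderiv ℝ w y (EuclideanSpace.single 2 (1 : ℝ)) = P (w y, y 2))
    (hK1 : ∀ y ∈ U, Λ (w y, y 2) *
        (fderiv ℝ (fun y' => fderiv ℝ w y' (EuclideanSpace.single 0 (1 : ℝ))) y (EuclideanSpace.single 0 (1 : ℝ)) + fderiv ℝ (fun y' => fderiv ℝ w y' (EuclideanSpace.single 1 (1 : ℝ))) y (EuclideanSpace.single 1 (1 : ℝ))) +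
      fderiv ℝ Λ (w y, y 2) (1, 0) * (fderiv ℝ w y (EuclideanSpace.single 0 (1 : ℝ)) ^ 2 + fderiv ℝ w y (EuclideanSpace.single 1 (1 : ℝ)) ^ 2) + c (w y, y 2) = 0)
    {y₁ : EuclideanSpace ℝ (Fin 3)} (hy₁ : y₁ ∈ U)
    (hD : Λ (w y₁, y₁ 2) * (Λ (w y₁, y₁ 2) * fderiv ℝ (fun q => fderiv ℝ P q ((1 : ℝ), (0 : ℝ))) (w y₁, y₁ 2) (1, 0) +
            fderiv ℝ (fun q => fderiv ℝ Λ q ((1 : ℝ), (0 : ℝ))) (w y₁, y₁ 2) (P (w y₁, y₁ 2), 1) +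
            2 * fderiv ℝ Λ (w y₁, y₁ 2) (1, 0) * fderiv ℝ P (w y₁, y₁ 2) (1, 0)) -
          fderiv ℝ Λ (w y₁, y₁ 2) (1, 0) *
            (fderiv ℝ Λ (w y₁, y₁ 2) (P (w y₁, y₁ 2), 1) + Λ (w y₁, y₁ 2) * fderiv ℝ P (w y₁, y₁ 2) (1, 0)) ≠ 0)
    (hnd : fderiv ℝ w y₁ (EuclideanSpace.single 0 (1 : ℝ)) ≠ 0 ∨ fderiv ℝ w y₁ (EuclideanSpace.single 1 (1 : ℝ)) ≠ 0) :
    ¬ IsBackwardSingularPoint v 0 := by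
  have hA : AnalyticOnNhd ℝ (v s) univ := analyticOnNhd_slice hcont (bdd_of_hasTypeITimeDecay hrate) hmild hs
  have hw3 : ContDiff ℝ 3 w := by rw [hwv]; exact contDiff_coord hA.contDiff 2
  obtain ⟨U₁, hU₁o, hy₁U₁, hU₁U, a, b, hab⟩ := exists_leafwise_nhds_of_wronskian₁_ne_zero hw3 hU hPd hΛd hcd hP hK1 hy₁ hD
  subst hwv
  exact not_isBackwardSingularPoint_of_leafwise' hrate hcont hmild hdiv hpol hs hU₁o hy₁U₁ (P := P) (a := a) (b := b)
    (fun y hy => (hPd y (hU₁U hy)).of_le (by norm_num)) (fun y hy => hP y (hU₁U hy))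
    (fun y hy => (hab y hy).1) (fun y hy => (hab y hy).2) hnd

/-- **BRANCH 2a ⇒ THE `LrcModEntire` GERM.**  As `lrcGerm_of_wronskian₁_ne_zero`, with the hypotheses of
`…UntwistedSeparation2.leafwise_of_dynWronskian_ne_zero` (dynamic identity `(V0)`, transport rule for `S`; here `P ∈ C²` at the leaf points and the pin
`Λ ≠ 0` on `U`) and ONE point `y₁ ∈ U` with `D₃(y₁) ≠ 0` and `∇ₕw(y₁) ≠ 0`. [folklore] -/
theorem lrcGerm_of_wronskian₃_ne_zero (hrate : HasTypeITimeDecay C v)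
    (hcont : ContinuousOn (uncurry v) (Iio (0 : ℝ) ×ˢ univ))
    (hmild : ∀ s t : ℝ, s < t → t < 0 → ∀ x,
      v t x = UnboundedOperators.heatExtension (v s) (t - s) x - oseenDuhamel 1 s v v t x)
    (hdiv : ∀ t < 0, VectorCalculus.IsDivFree (v t))
    (hpol : ∀ s < 0, ∀ y, ⟪curl (v s) y, EuclideanSpace.single 2 1⟫_ℝ = 0)
    {s : ℝ} (hs : s < 0) {w : EuclideanSpace ℝ (Fin 3) → ℝ} (hwv : w = fun x => v s x 2)
    {P Λ c k pt : ℝ × ℝ → ℝ} {S : EuclideanSpace ℝ (Fin 3) → ℝ} {U : Set (EuclideanSpace ℝ (Fin 3))} (hU : IsOpen U)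
    (hPd : ∀ y ∈ U, ContDiffAt ℝ 2 P (w y, y 2)) (hΛd : ∀ y ∈ U, ContDiffAt ℝ 2 Λ (w y, y 2))
    (hcd : ∀ y ∈ U, DifferentiableAt ℝ c (w y, y 2)) (hkd : ∀ y ∈ U, DifferentiableAt ℝ k (w y, y 2))
    (hSd : ∀ y ∈ U, DifferentiableAt ℝ S y)
    (hΛ0 : ∀ y ∈ U, Λ (w y, y 2) ≠ 0)
    (hP : ∀ y ∈ U, fderiv ℝ w y (EuclideanSpace.single 2 (1 : ℝ)) = P (w y, y 2))
    (hSz : ∀ y ∈ U, fderiv ℝ S y (EuclideanSpace.single 2 (1 : ℝ)) =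
      fderiv ℝ P (w y, y 2) (1, 0) * S y + Λ (w y, y 2) *
        (fderiv ℝ w y (EuclideanSpace.single 0 (1 : ℝ)) ^ 2 + fderiv ℝ w y (EuclideanSpace.single 1 (1 : ℝ)) ^ 2) + pt (w y, y 2))
    (hK1 : ∀ y ∈ U, Λ (w y, y 2) *
        (fderiv ℝ (fun y' => fderiv ℝ w y' (EuclideanSpace.single 0 (1 : ℝ))) y (EuclideanSpace.single 0 (1 : ℝ)) +
          fderiv ℝ (fun y' => fderiv ℝ w y' (EuclideanSpace.single 1 (1 : ℝ))) y (EuclideanSpace.single 1 (1 : ℝ))) +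
      fderiv ℝ Λ (w y, y 2) (1, 0) *
        (fderiv ℝ w y (EuclideanSpace.single 0 (1 : ℝ)) ^ 2 + fderiv ℝ w y (EuclideanSpace.single 1 (1 : ℝ)) ^ 2) + c (w y, y 2) = 0)
    (hV0 : ∀ y ∈ U, (1 - Λ (w y, y 2)) * S y = (1 - Λ (w y, y 2)) *
        (fderiv ℝ (fun y' => fderiv ℝ w y' (EuclideanSpace.single 0 (1 : ℝ))) y (EuclideanSpace.single 0 (1 : ℝ)) +
          fderiv ℝ (fun y' => fderiv ℝ w y' (EuclideanSpace.single 1 (1 : ℝ))) y (EuclideanSpace.single 1 (1 : ℝ))) -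
      fderiv ℝ Λ (w y, y 2) (1, 0) *
        (fderiv ℝ w y (EuclideanSpace.single 0 (1 : ℝ)) ^ 2 + fderiv ℝ w y (EuclideanSpace.single 1 (1 : ℝ)) ^ 2) + k (w y, y 2))
    {y₁ : EuclideanSpace ℝ (Fin 3)} (hy₁ : y₁ ∈ U)
    (hD : (Λ (w y₁, y₁ 2) * (1 - Λ (w y₁, y₁ 2))) *
            (Λ (w y₁, y₁ 2) * (1 - Λ (w y₁, y₁ 2)) * Λ (w y₁, y₁ 2) +
              fderiv ℝ (fun q => fderiv ℝ Λ q ((1 : ℝ), (0 : ℝ))) (w y₁, y₁ 2) (P (w y₁, y₁ 2), 1) +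
              2 * fderiv ℝ Λ (w y₁, y₁ 2) (1, 0) * fderiv ℝ P (w y₁, y₁ 2) (1, 0)) -
          fderiv ℝ Λ (w y₁, y₁ 2) (1, 0) *
            ((1 - 2 * Λ (w y₁, y₁ 2)) * fderiv ℝ Λ (w y₁, y₁ 2) (P (w y₁, y₁ 2), 1) +
              Λ (w y₁, y₁ 2) * (1 - Λ (w y₁, y₁ 2)) * fderiv ℝ P (w y₁, y₁ 2) (1, 0)) ≠ 0)
    (hnd : fderiv ℝ w y₁ (EuclideanSpace.single 0 (1 : ℝ)) ≠ 0 ∨ fderiv ℝ w y₁ (EuclideanSpace.single 1 (1 : ℝ)) ≠ 0) :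
    ∃ s' : ℝ, s' < 0 ∧ ∃ U' : Set (EuclideanSpace ℝ (Fin 3)), IsOpen U' ∧ U'.Nonempty ∧
      ((∃ e : EuclideanSpace ℝ (Fin 3), e ≠ 0 ∧ ∀ y ∈ U', fderiv ℝ (curl (v s')) y e = 0) ∨
       (∃ c : EuclideanSpace ℝ (Fin 3), ∀ y ∈ U',
          rotGen (curl (v s') y) = fderiv ℝ (curl (v s')) y (rotGen (y - c))) ∨
       (∃ w : EuclideanSpace ℝ (Fin 3) → EuclideanSpace ℝ (Fin 3), AnalyticOnNhd ℝ w univ ∧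
          ¬ BddAbove (Set.range fun y => ‖w y‖) ∧ ∀ y ∈ U', v s' y = w y)) := by
  have hA : AnalyticOnNhd ℝ (v s) univ := analyticOnNhd_slice hcont (bdd_of_hasTypeITimeDecay hrate) hmild hs
  have hw3 : ContDiff ℝ 3 w := by rw [hwv]; exact contDiff_coord hA.contDiff 2
  obtain ⟨U₁, hU₁o, hy₁U₁, hU₁U, a, b, hab⟩ :=
    exists_leafwise_nhds_of_wronskian₃_ne_zero hw3 hU hPd hΛd hcd hkd hSd hΛ0 hP hSz hK1 hV0 hy₁ hD
  subst hwv
  exact lrcGerm_of_leafwise' hrate hcont hmild hdiv hpol hs hU₁o hy₁U₁ (P := P) (a := a) (b := b)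
    (fun y hy => (hPd y (hU₁U hy)).of_le (by norm_num)) (fun y hy => hP y (hU₁U hy))
    (fun y hy => (hab y hy).1) (fun y hy => (hab y hy).2) hnd

/-- **BRANCH 2a ⇒ `¬ IsBackwardSingularPoint`** (same hypotheses). [folklore] -/
theorem not_isBackwardSingularPoint_of_wronskian₃_ne_zero (hrate : HasTypeITimeDecay C v)
    (hcont : ContinuousOn (uncurry v) (Iio (0 : ℝ) ×ˢ univ))
    (hmild : ∀ s t : ℝ, s < t → t < 0 → ∀ x,
      v t x = UnboundedOperators.heatExtension (v s) (t - s) x - oseenDuhamel 1 s v v t x)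
    (hdiv : ∀ t < 0, VectorCalculus.IsDivFree (v t))
    (hpol : ∀ s < 0, ∀ y, ⟪curl (v s) y, EuclideanSpace.single 2 1⟫_ℝ = 0)
    {s : ℝ} (hs : s < 0) {w : EuclideanSpace ℝ (Fin 3) → ℝ} (hwv : w = fun x => v s x 2)
    {P Λ c k pt : ℝ × ℝ → ℝ} {S : EuclideanSpace ℝ (Fin 3) → ℝ} {U : Set (EuclideanSpace ℝ (Fin 3))} (hU : IsOpen U)
    (hPd : ∀ y ∈ U, ContDiffAt ℝ 2 P (w y, y 2)) (hΛd : ∀ y ∈ U, ContDiffAt ℝ 2 Λ (w y, y 2))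
    (hcd : ∀ y ∈ U, DifferentiableAt ℝ c (w y, y 2)) (hkd : ∀ y ∈ U, DifferentiableAt ℝ k (w y, y 2))
    (hSd : ∀ y ∈ U, DifferentiableAt ℝ S y)
    (hΛ0 : ∀ y ∈ U, Λ (w y, y 2) ≠ 0)
    (hP : ∀ y ∈ U, fderiv ℝ w y (EuclideanSpace.single 2 (1 : ℝ)) = P (w y, y 2))
    (hSz : ∀ y ∈ U, fderiv ℝ S y (EuclideanSpace.single 2 (1 : ℝ)) =
      fderiv ℝ P (w y, y 2) (1, 0) * S y + Λ (w y, y 2) *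
        (fderiv ℝ w y (EuclideanSpace.single 0 (1 : ℝ)) ^ 2 + fderiv ℝ w y (EuclideanSpace.single 1 (1 : ℝ)) ^ 2) + pt (w y, y 2))
    (hK1 : ∀ y ∈ U, Λ (w y, y 2) *
        (fderiv ℝ (fun y' => fderiv ℝ w y' (EuclideanSpace.single 0 (1 : ℝ))) y (EuclideanSpace.single 0 (1 : ℝ)) +
          fderiv ℝ (fun y' => fderiv ℝ w y' (EuclideanSpace.single 1 (1 : ℝ))) y (EuclideanSpace.single 1 (1 : ℝ))) +
      fderiv ℝ Λ (w y, y 2) (1, 0) *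
        (fderiv ℝ w y (EuclideanSpace.single 0 (1 : ℝ)) ^ 2 + fderiv ℝ w y (EuclideanSpace.single 1 (1 : ℝ)) ^ 2) + c (w y, y 2) = 0)
    (hV0 : ∀ y ∈ U, (1 - Λ (w y, y 2)) * S y = (1 - Λ (w y, y 2)) *
        (fderiv ℝ (fun y' => fderiv ℝ w y' (EuclideanSpace.single 0 (1 : ℝ))) y (EuclideanSpace.single 0 (1 : ℝ)) +
          fderiv ℝ (fun y' => fderiv ℝ w y' (EuclideanSpace.single 1 (1 : ℝ))) y (EuclideanSpace.single 1 (1 : ℝ))) -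
      fderiv ℝ Λ (w y, y 2) (1, 0) *
        (fderiv ℝ w y (EuclideanSpace.single 0 (1 : ℝ)) ^ 2 + fderiv ℝ w y (EuclideanSpace.single 1 (1 : ℝ)) ^ 2) + k (w y, y 2))
    {y₁ : EuclideanSpace ℝ (Fin 3)} (hy₁ : y₁ ∈ U)
    (hD : (Λ (w y₁, y₁ 2) * (1 - Λ (w y₁, y₁ 2))) *
            (Λ (w y₁, y₁ 2) * (1 - Λ (w y₁, y₁ 2)) * Λ (w y₁, y₁ 2) +
              fderiv ℝ (fun q => fderiv ℝ Λ q ((1 : ℝ), (0 : ℝ))) (w y₁, y₁ 2) (P (w y₁, y₁ 2), 1) +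
              2 * fderiv ℝ Λ (w y₁, y₁ 2) (1, 0) * fderiv ℝ P (w y₁, y₁ 2) (1, 0)) -
          fderiv ℝ Λ (w y₁, y₁ 2) (1, 0) *
            ((1 - 2 * Λ (w y₁, y₁ 2)) * fderiv ℝ Λ (w y₁, y₁ 2) (P (w y₁, y₁ 2), 1) +
              Λ (w y₁, y₁ 2) * (1 - Λ (w y₁, y₁ 2)) * fderiv ℝ P (w y₁, y₁ 2) (1, 0)) ≠ 0)
    (hnd : fderiv ℝ w y₁ (EuclideanSpace.single 0 (1 : ℝ)) ≠ 0 ∨ fderiv ℝ w y₁ (EuclideanSpace.single 1 (1 : ℝ)) ≠ 0) :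
    ¬ IsBackwardSingularPoint v 0 := by
  have hA : AnalyticOnNhd ℝ (v s) univ := analyticOnNhd_slice hcont (bdd_of_hasTypeITimeDecay hrate) hmild hs
  have hw3 : ContDiff ℝ 3 w := by rw [hwv]; exact contDiff_coord hA.contDiff 2
  obtain ⟨U₁, hU₁o, hy₁U₁, hU₁U, a, b, hab⟩ :=
    exists_leafwise_nhds_of_wronskian₃_ne_zero hw3 hU hPd hΛd hcd hkd hSd hΛ0 hP hSz hK1 hV0 hy₁ hD
  subst hwv
  exact not_isBackwardSingularPoint_of_leafwise' hrate hcont hmild hdiv hpol hs hU₁o hy₁U₁ (P := P) (a := a) (b := b)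
    (fun y hy => (hPd y (hU₁U hy)).of_le (by norm_num)) (fun y hy => hP y (hU₁U hy))
    (fun y hy => (hab y hy).1) (fun y hy => (hab y hy).2) hnd

end Summit.NavierStokesRegularity.NavierStokesRegularity.Theorems.PoloidalWindowDoorPoloidalWindowRigidityUntwistedLeafwiseGerm

end
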